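import Summits.BirchSwinnertonDyer.BirchSwinnertonDyer.Theorems.ResidualThetaTransportAtTwoThetaLayerLambdaCongruenceAtTwoSdTorsionShapiroLift
import HarnessLib

/-!
# Crux Kan⁺ `ThetaLayerLambdaCongruenceAtTwo` (stmt-BirchSwinnertonDyer-20688), SD floor, brick S1 —
# parabolic–elliptic cocycles of `Γ₀(N)` over an arbitrary field, IIIb: the count
# (width seat bsd-wall-rtt-p3-w4 g6; `--supports stmt-BirchSwinnertonDyer-20688`; proofs + internal carriers only,
# no named fact, no `sorry`; BSD is not proved by any of this)

For a field `K` (any characteristic) let `H = parEllCocycles K N` be the space of maps `u : Γ₀(N) → K` which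
are additive (`u(γδ) = u(γ) + u(δ)`) and vanish on every PARABOLIC and on every ELLIPTIC element of
`Γ₀(N)` (Mathlib `Matrix.IsParabolic`, `Matrix.IsElliptic`) — the group-theoretic model of
`H¹(X₀(N)(ℂ), K) = Hom(π₁(X₀(N)), K)`, `π₁(X₀(N)) = Γ₀(N)/⟨⟨±1, elliptic, parabolic⟩⟩`. This file proves (with the
Shapiro lift of IIIa `…SdTorsionShapiroLift`) the characteristic-free Shimura count

  `6 dim_K H + 3ε₂ + 4ε₃ + 6ε_∞ ≤ 12 + μ`   (`six_mul_finrank_parEllCocycles_le`),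

hence `dim_K H ≤ 2 dim_ℂ S₂(Γ₀(N))` (`finrank_parEllCocycles_le_two_mul_finrank`, with the tree's
`12 dim S₂(Γ₀(N)) + 3ε₂ + 4ε₃ + 6ε_∞ = 12 + μ`). The proof is the `ℝ`-proof of
`ModularSymbolsParabolicCohomologyProofs` (Shapiro lift `E_u(g)(x) = u(s(gx)⁻¹ g s(x))` into `K^X`,
`X = SL(2, ℤ)/Γ₀(N)`; the cocycle is determined by `E(S), E(T)`; three linear conditions; counting) with
TWO CHANGES that make it work in characteristic `2` and `3`:
* `E(-1) = 0` is obtained from `-1 = (-T)·T⁻¹`, a product of two parabolic elements (not from `2u(-1) = 0`);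
* the elliptic hypothesis gives the EXTRA linear conditions `E(S)(x) = u(s(x)⁻¹ S s(x)) = 0` at the `S`-fixed
  cosets and `E(ST)(x) = 0` at the `ST`-fixed cosets (`s(x)⁻¹Ss(x)`, `s(x)⁻¹STs(x)` are then elliptic elements
  of `Γ₀(N)`), so `(E(S), E(T))` lies in the refined solution space built from `kerS`, `kerST` of part I,
  whose dimensions part II bounds by orbit counting (`2 dim kerS + ε₂ ≤ μ`, `3 dim kerST + 2ε₃ ≤ 2μ`) in
  place of the characteristic-`0` trace identities.
Part IV (`…SdTorsionEichlerShimura`) turns the count into the factorisation of every `u ∈ H` through the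
period map `γ ↦ {∞, γ∞}` (`periodFunctional N`), i.e. `Λ/ℓΛ ≅ Γ₀(N)ᵃᵇ/⟨±1, ell, par⟩ ⊗ 𝔽_ℓ`.

## References
* G. Shimura, *Introduction to the arithmetic theory of automorphic functions* (1971), §8.1–8.2
  (Prop. 8.1, (8.2.24)) [ShimuraIATAF1971].
* G. Wiese, Multiplicities of Galois representations of weight one, ANT 1 (2007), §2–3 [Wiese2007Multiplicities].
* K. S. Brown, *Cohomology of groups* (1982), III.6 (Shapiro's lemma) [Brown1982CohomologyGroups].
-/

-- justification: the `Summit.BirchSwinnertonDyer.BirchSwinnertonDyer.…` path repeats a component (route-file convention)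
set_option linter.dupNamespace false
set_option autoImplicit false

noncomputable section

open scoped MatrixGroups ModularForm

open CongruenceSubgroup Matrix.SpecialLinearGroup ModularGroup

open Literature.NumberTheory.EllipticCurves.ModularForms

namespace Summit.BirchSwinnertonDyer.BirchSwinnertonDyer.Theorems.SdTorsion

namespace ParabolicCountK

open _root_.Module _root_.LinearMap
open scoped Classical

variable {K : Type*} [Field K] {N : ℕ}

variable [NeZero N]

/-! ### The comparison map `u ⊕ f ↦ ((E_u + δf)(S), (E_u + δf)(T))` and its kernel -/

variable (K N)

/-- `u ↦ (E_u(S), E_u(T))`. [folklore] -/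
def liftPair : parEllCocycles K N →ₗ[K] (Gamma0Coset N → K) × (Gamma0Coset N → K) where
  toFun u := (lift (u : Gamma0 N → K) S, lift (u : Gamma0 N → K) T)
  map_add' u v := by
    ext x <;> simp
  map_smul' c u := by
    ext x <;> simp

/-- `f ↦ (δf(S), δf(T))`. [folklore] -/
def cobdPair : (Gamma0Coset N → K) →ₗ[K] (Gamma0Coset N → K) × (Gamma0Coset N → K) where
  toFun f := (cobd f S, cobd f T)
  map_add' f f' := by
    ext x <;> simp [cobd] <;> ring
  map_smul' c f := by
    ext x <;> simp [cobd] <;> ring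

/-- The **comparison map** `Λ(u, f) = ((E_u + δf)(S), (E_u + δf)(T))` on `H ⊕ K^X`. [folklore] -/
def lam : (parEllCocycles K N × (Gamma0Coset N → K)) →ₗ[K]
    (Gamma0Coset N → K) × (Gamma0Coset N → K) :=
  (liftPair K N).coprod (cobdPair K N)

omit [NeZero N] in
/-- Unfolding `lam`. [folklore] -/
theorem lam_apply (p : parEllCocycles K N × (Gamma0Coset N → K)) :
    lam K N p = (tot (p.1 : Gamma0 N → K) p.2 S, tot (p.1 : Gamma0 N → K) p.2 T) := rfl

omit [NeZero N] in
/-- **The kernel of `Λ` is `0 ⊕ (constants)`**: if `(E_u + δf)(S) = (E_u + δf)(T) = 0` then `E_u + δf = 0`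
on `SL(2, ℤ) = ⟨S, T⟩`, so `u(γ) = (E_u + δf)(γ)(Γ₀(N)) = 0`, and then `g^*f = f` for all `g`, i.e. `f` is
constant (`SL(2, ℤ)` is transitive on `X`). [folklore] -/
theorem ker_lam_le (p : parEllCocycles K N × (Gamma0Coset N → K)) (hp : p ∈ LinearMap.ker (lam K N)) :
    p.1 = 0 ∧ ∀ x, p.2 x = p.2 ((1 : SL(2, ℤ)) : Gamma0Coset N) := by
  obtain ⟨u, f⟩ := p
  have hu := (mem_parEllCocycles_iff.mp u.2).1
  rw [LinearMap.mem_ker, lam_apply, Prod.mk_eq_zero] at hp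
  have hall := tot_eq_zero_of_S_T hu f hp.1 hp.2
  have hu0 : u = 0 := by
    apply Subtype.ext
    funext γ
    have h := tot_apply_coe_one hu f γ
    rw [hall, Pi.zero_apply] at h
    simp [← h]
  refine ⟨hu0, fun x ↦ ?_⟩
  have hcobd : ∀ g, cobd f g = 0 := fun g ↦ by
    have h := hall g
    rw [tot, hu0] at h
    have h0 : lift ((0 : parEllCocycles K N) : Gamma0 N → K) g = 0 := by
      funext y
      simp
    rwa [h0, zero_add] at h
  have hx : x = ParabolicCount.sec x • ((1 : SL(2, ℤ)) : Gamma0Coset N) := by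
    rw [MulAction.Quotient.smul_mk, smul_eq_mul, mul_one, ParabolicCount.coe_sec]
  have h := congr_fun (hcobd (ParabolicCount.sec x)) ((1 : SL(2, ℤ)) : Gamma0Coset N)
  rw [cobd, Pi.sub_apply, coperm_apply, Pi.zero_apply, sub_eq_zero, ← hx] at h
  exact h

omit [NeZero N] in
/-- `dim ker Λ ≤ 1`. [folklore] -/
theorem finrank_ker_lam_le_one : finrank K (LinearMap.ker (lam K N)) ≤ 1 := by
  let φ : LinearMap.ker (lam K N) →ₗ[K] K :=
    { toFun := fun p ↦ (p : parEllCocycles K N × (Gamma0Coset N → K)).2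
        ((1 : SL(2, ℤ)) : Gamma0Coset N)
      map_add' := fun _ _ ↦ rfl
      map_smul' := fun _ _ ↦ rfl }
  have hφ : Function.Injective φ := by
    intro p q hpq
    obtain ⟨hp1, hp2⟩ := ker_lam_le K N p.1 p.2
    obtain ⟨hq1, hq2⟩ := ker_lam_le K N q.1 q.2
    apply Subtype.ext
    apply Prod.ext
    · rw [hp1, hq1]
    · funext x
      rw [hp2 x, hq2 x]
      exact hpq
  have h := LinearMap.finrank_le_finrank_of_injective hφ
  rwa [Module.finrank_self] at h

omit [NeZero N] in
/-- `u ↦ (E_u(S), E_u(T))` is injective on the parabolic–elliptic cocycles (the case `f = 0` of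
`ker_lam_le`). [folklore] -/
theorem liftPair_injective : Function.Injective (liftPair K N) := by
  intro u v huv
  have h : (u - v, (0 : Gamma0Coset N → K)) ∈ LinearMap.ker (lam K N) := by
    rw [LinearMap.mem_ker, lam, LinearMap.coprod_apply, map_zero, add_zero, map_sub, huv, sub_self]
  exact sub_eq_zero.mp (ker_lam_le K N _ h).1

/-- **`H = parEllCocycles K N` is finite-dimensional** (`N ≥ 1`; it injects into `K^X × K^X` by `liftPair`;
cf. Shimura Prop. 8.3: a cocycle is determined by its values on generators). [folklore] -/
theorem finite_parEllCocycles : Module.Finite K (parEllCocycles K N) :=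
  FiniteDimensional.of_injective (liftPair K N) (liftPair_injective K N)

/-! ### The refined solution space and the count -/

/-- The **refined solution space** `W ⊆ K^X × K^X`: pairs `(a, b)` with `a ∈ kerS` (`(1 + S^*)a = 0`,
`a = 0` on the `S`-fixed cosets), `T^*a + b ∈ kerST` (`(1 + U + U²)(T^*a + b) = 0`, `T^*a + b = 0` on the
`ST`-fixed cosets) and `cusp sums of b = 0`. [folklore] -/
def solSpace : Submodule K ((Gamma0Coset N → K) × (Gamma0Coset N → K)) :=
  (kerS K N).comap (LinearMap.fst K _ _) ⊓
    ((kerST K N).comap (coperm T ∘ₗ LinearMap.fst K _ _ + LinearMap.snd K _ _) ⊓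
      LinearMap.ker (cuspSum K N ∘ₗ LinearMap.snd K _ _))

/-- Membership in `solSpace`. [folklore] -/
theorem mem_solSpace_iff (p : (Gamma0Coset N → K) × (Gamma0Coset N → K)) :
    p ∈ solSpace K N ↔ p.1 ∈ kerS K N ∧ coperm T p.1 + p.2 ∈ kerST K N ∧ cuspSum K N p.2 = 0 := by
  simp [solSpace]

/-- **`Λ` lands in the refined solution space**: `(1 + S^*)E(S) = E(S²) = E(-1) = 0` and `E(S) = 0` on the
`S`-fixed cosets; `T^*E(S) + E(T) = E(ST)` satisfies `(1 + U + U²)E(ST) = E((ST)³) = E(-1) = 0` and vanishes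
on the `ST`-fixed cosets; the cusp sums of `E(T) = E_u(T) + T^*f - f` vanish. [folklore] -/
theorem range_lam_le : LinearMap.range (lam K N) ≤ solSpace K N := by
  rintro _ ⟨⟨u, f⟩, rfl⟩
  have hu := (mem_parEllCocycles_iff.mp u.2).1
  have hpar := (mem_parEllCocycles_iff.mp u.2).2.1
  rw [mem_solSpace_iff, lam_apply]
  refine ⟨⟨?_, fun x hx ↦ ?_⟩, ?_, ?_⟩
  · have h := tot_mul hu f S S
    rw [S_mul_S_eq_neg_one, tot_neg_one hu hpar] at h
    rw [relS, LinearMap.add_apply, LinearMap.id_apply, add_comm]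
    exact h.symm
  · change tot (u : Gamma0 N → K) f S x = 0
    rw [tot, Pi.add_apply, lift_S_apply_eq_zero u hx, cobd_apply_eq_zero_of_smul_eq f hx, add_zero]
  · have hST : coperm T (tot (u : Gamma0 N → K) f S) + tot (u : Gamma0 N → K) f T =
        tot (u : Gamma0 N → K) f (S * T) := (tot_mul hu f S T).symm
    rw [hST]
    refine ⟨?_, fun x hx ↦ ?_⟩
    · have h3 := tot_mul hu f (S * T * (S * T)) (S * T)
      rw [ParabolicCount.ST_pow_three_eq, tot_neg_one hu hpar, tot_mul hu f (S * T) (S * T), map_add] at h3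
      rw [relST]
      simp only [LinearMap.add_apply, LinearMap.id_apply, LinearMap.comp_apply]
      rw [eq_comm] at h3
      convert h3 using 1
      abel
    · rw [tot, Pi.add_apply, lift_S_mul_T_apply_eq_zero u hx, cobd_apply_eq_zero_of_smul_eq f hx,
        add_zero]
  · change cuspSum K N (tot (u : Gamma0 N → K) f T) = 0
    rw [tot, map_add, cuspSum_lift_T u, zero_add, cobd, map_sub, cuspSum_coperm_T, sub_self]

/-- **`dim W ≤ dim kerS + dim(kerST ∩ ker(cusp sums))`**: project `W` to the first factor; the fibre over
`a = 0` is `kerST ∩ ker(cusp sums)`. [folklore] -/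
theorem finrank_solSpace_le :
    finrank K (solSpace K N) ≤ finrank K (kerS K N) +
      finrank K ↥(kerST K N ⊓ LinearMap.ker (cuspSum K N)) := by
  let π : solSpace K N →ₗ[K] (Gamma0Coset N → K) := LinearMap.fst K _ _ ∘ₗ (solSpace K N).subtype
  have hπ := LinearMap.finrank_range_add_finrank_ker π
  have hrange : LinearMap.range π ≤ kerS K N := by
    rintro _ ⟨p, rfl⟩
    exact ((mem_solSpace_iff K N p.1).mp p.2).1
  have h1 := Submodule.finrank_mono hrange
  let ψ : LinearMap.ker π →ₗ[K] (Gamma0Coset N → K) :=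
    LinearMap.snd K _ _ ∘ₗ (solSpace K N).subtype ∘ₗ (LinearMap.ker π).subtype
  have hker : ∀ p : LinearMap.ker π,
      ((p : solSpace K N) : (Gamma0Coset N → K) × (Gamma0Coset N → K)).1 = 0 :=
    fun p ↦ LinearMap.mem_ker.mp p.2
  have hψinj : Function.Injective ψ := by
    intro p q hpq
    apply Subtype.ext
    apply Subtype.ext
    exact Prod.ext (by rw [hker p, hker q]) hpq
  have hψrange : LinearMap.range ψ ≤ kerST K N ⊓ LinearMap.ker (cuspSum K N) := by
    rintro _ ⟨p, rfl⟩
    obtain ⟨-, h2, h3⟩ := (mem_solSpace_iff K N _).mp (p : solSpace K N).2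
    rw [hker p, map_zero, zero_add] at h2
    exact ⟨h2, h3⟩
  have h2 := Submodule.finrank_mono hψrange
  rw [LinearMap.finrank_range_of_inj hψinj] at h2
  omega

/-- **`dim_K H ≤ 2g(X₀(N))` in every characteristic**, in the form
`6 dim_K H + 3ε₂ + 4ε₃ + 6ε_∞ ≤ 12 + μ` (`H = parEllCocycles K N`, `μ = [SL(2, ℤ) : Γ₀(N)]`,
`ε₂ = #{x : Sx = x}`, `ε₃ = #{x : TSx = x}`, `ε_∞` the number of cusps; `2g = 2 + μ/6 - ε₂/2 - 2ε₃/3 - ε_∞`):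
`dim H + μ ≤ dim ker Λ + dim W ≤ 1 + dim kerS + dim kerST + dim ker(cusp sums) + 1 - μ` with
`2 dim kerS + ε₂ ≤ μ`, `3 dim kerST + 2ε₃ ≤ 2μ` (orbit counting, part II), `dim ker(cusp sums) = μ - ε_∞`.
[cite: ShimuraIATAF1971, §8.2 (8.2.24) with Prop. 8.1 (case n = 0), here over an arbitrary field] -/
theorem six_mul_finrank_parEllCocycles_le :
    6 * finrank K (parEllCocycles K N) + 3 * Nat.card {q : SL(2, ℤ) ⧸ Gamma0 N // S • q = q} +
        4 * Nat.card {q : SL(2, ℤ) ⧸ Gamma0 N // (T * S) • q = q} +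
        6 * Nat.card (CuspOrbits (Gamma0 N : Subgroup (GL (Fin 2) ℝ))) ≤
      12 + (Gamma0 N).index := by
  haveI := finite_parEllCocycles K N
  -- notation and the numerical inputs
  have hμ : (Gamma0 N).index = Fintype.card (Gamma0Coset N) := by
    rw [Subgroup.index, Nat.card_eq_fintype_card]
  have hε₂ : Nat.card {q : SL(2, ℤ) ⧸ Gamma0 N // S • q = q} =
      (Finset.univ.filter fun q : Gamma0Coset N ↦ S • q = q).card := by
    rw [Nat.card_eq_fintype_card, Fintype.card_subtype]
  have hε₃ : Nat.card {q : SL(2, ℤ) ⧸ Gamma0 N // (T * S) • q = q} =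
      (Finset.univ.filter fun q : Gamma0Coset N ↦ (S * T) • q = q).card := by
    rw [card_fixed_TS_eq_card_fixed_ST, Nat.card_eq_fintype_card, Fintype.card_subtype]
  have hε : Nat.card (CuspOrbits (Gamma0 N : Subgroup (GL (Fin 2) ℝ))) = (basePoints N).card := by
    rw [card_basePoints, ← numCusps_eq_nuInfty_holds N, numCusps]
  -- orbit counting (part II) and the cusp sums (part I)
  have hA := two_mul_finrank_kerS_add_card_le (K := K) (N := N)
  have hB := three_mul_finrank_kerST_add_card_le (K := K) (N := N)
  have hC := finrank_range_cuspSum (K := K) (N := N)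
  have hC' := LinearMap.finrank_range_add_finrank_ker (cuspSum K N)
  rw [finrank_fintype_fun_eq_card] at hC'
  -- `dim (kerST ∩ ker C) + μ ≤ dim kerST + dim ker C + 1`
  have hsup := Submodule.finrank_sup_add_finrank_inf_eq (kerST K N) (LinearMap.ker (cuspSum K N))
  have hcodim := card_le_finrank_kerST_sup_add_one (K := K) (N := N)
  -- `dim H + μ = dim ker Λ + dim range Λ ≤ 1 + dim W`
  have hΛ := LinearMap.finrank_range_add_finrank_ker (lam K N)
  rw [Module.finrank_prod, finrank_fintype_fun_eq_card] at hΛ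
  have hker := finrank_ker_lam_le_one K N
  have hrange := Submodule.finrank_mono (range_lam_le K N)
  have hW := finrank_solSpace_le K N
  rw [hμ, hε₂, hε₃, hε]
  omega

/-- **`dim_K H¹_{par, ell}(Γ₀(N), K) ≤ 2 dim_ℂ S₂(Γ₀(N))`** for `N ≥ 1` and EVERY field `K`: the count
`six_mul_finrank_parEllCocycles_le` against the dimension formula
`12 dim S₂(Γ₀(N)) + 3ε₂ + 4ε₃ + 6ε_∞ = 12 + μ` (`twelve_mul_finrank_cuspForm_two_gamma0_holds`).
[cite: ShimuraIATAF1971, §8.2 (8.2.23)–(8.2.24), here over an arbitrary field] -/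
theorem finrank_parEllCocycles_le_two_mul_finrank :
    finrank K (parEllCocycles K N) ≤ 2 * finrank ℂ (CuspForm (Gamma0 N) 2) := by
  have h₁ := six_mul_finrank_parEllCocycles_le K N
  have h₂ := twelve_mul_finrank_cuspForm_two_gamma0_holds N (Gamma0_is_congruence N)
  rw [adjoinNegI_gamma0, ellipticPointCount_two_gamma0_eq_card,
    ellipticPointCount_three_gamma0_eq_card] at h₂
  omega

end ParabolicCountK

end Summit.BirchSwinnertonDyer.BirchSwinnertonDyer.Theorems.SdTorsion

end
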